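import Literature.Probability.NegativeDependence.AlmostExchangeableCNA
import Literature.Probability.NegativeDependence.RayleighCounterexamples
import HarnessLib

/-!
# The 20-variable counterexample is CNA+: Conjectures 2.3, 2.5 and 2.9 fail (Borcea–Brändén–Liggett §7)

J. Borcea, P. Brändén, T. M. Liggett, *Negative dependence and the geometry of polynomials*, J. Amer. Math. Soc.
22 (2009) 521–567 (arXiv:0707.2340, held `paper:arxiv-0707.2340`), §2.1–§2.4 and §7. Verbatim:

> **Conjecture 2.3.** If `μ ∈ 𝔓_n` is NA then it is ULC. [Pemantle]
> **Conjecture 2.5.** If `μ ∈ 𝔓_n` is CNA+ then it is ULC. [the weakest form of Pemantle's Conjecture 4]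
> **Conjecture 2.9.** Suppose that `μ` is CNA+ and that `μ({S ∈ 2^{[n]} : |S| = k}) μ({S ∈ 2^{[n]} : |S| = k+1}) > 0`.
> Then `μ_k ≼ μ_{k+1}`. [Pemantle]
> (§7, Counterexample 1.) […] In light of Proposition 6.2 and Corollary 6.5, Conjectures 2.4 and 2.5 reduce to the
> following problem in the almost exchangeable case. […] By taking e.g. `t = 10^{-4}` one can then check that the
> corresponding sequences `{a_k}_{k=0}^m` and `{b_k/m}_{k=0}^m` constructed in (7.1) produce a counterexample to
> Problem 7.1 for any integer `m ≥ 19`. Therefore, both Conjecture 2.4 and Conjecture 2.5 fail whenever the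
> (total) number of variables satisfies `n+1 ≥ 20`.
> (§7, Counterexample 2.) Let `f` […] be the `n+1 = 20` variable polynomial in the previous counterexample and let
> `μ` be the corresponding probability measure in `𝔓_{n+1}`, so that `μ` is CNA+. For `𝒜 = {S ∈ 2^{[n+1]} : n+1 ∈ S}`
> […] `μ_k(𝒜) ≤ μ_{k+1}(𝒜)` ⟺ […]. This fails for `k = 3` and `0 < t < 1/18`. □ [so Conjecture 2.9 fails]

## What is here

The tree's `RayleighCounterexamples.lean` has the Rayleigh parts of Counterexamples 1–2 for the weight
`ceWeight = almostExch ceA ceB'` on `2^[20]` (`t = 10^{-4}`, `m = n = 19`): Rayleigh, rank sequence not ULC,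
`μ_3 ⋠ μ_4`; its docstring defers "the CNA+ assertions of §7 (Conjectures 2.3, 2.5, 2.9 as printed, via
Cor. 6.5)". With Corollary 6.5 in the tree (`isCNAPlus_almostExch`, `AlmostExchangeableCNA.lean`) these follow:

* §1 positive rescaling preserves NA / CNA / CNA+ and the truncations (`IsNegAssoc.smul`, `IsCNA.smul`,
  `IsCNAPlus.smul`, `truncMeasure_smul`) — to pass to the probability measure `μ/μ(Ω) ∈ 𝔓_20`;
* §2 **`isCNAPlus_ceWeight`** (Cor. 6.5 with the printed inequalities, already checked in the tree:
  `isLogConcaveSeq_ceA`, `isLogConcaveSeq_ceA_ceB'`, `condition_ii_ce`), `isCNA_ceWeight`, `isNegAssoc_ceWeight`;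
* §3 **`BorceaBrandenLiggett_conjecture_2_5_fails`** (a CNA+ probability measure on `2^[20]` that is not ULC),
  **`BorceaBrandenLiggett_conjecture_2_3_fails`** (NA, not ULC), **`BorceaBrandenLiggett_conjecture_2_9_fails`**
  (CNA+, `r_3 r_4 > 0`, `μ_3 ⋠ μ_4`).

## References

* [BorceaBrandenLiggett2007] J. Borcea, P. Brändén, T. M. Liggett, Negative dependence and the geometry of
  polynomials, J. Amer. Math. Soc. 22 (2009); arXiv:0707.2340 — §2.1 Conj. 2.3, 2.5, §2.4 Conj. 2.9, Def.
  2.14–2.15; §6 Cor. 6.5; §7 Counterexamples 1, 2.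
* [Pemantle2000] R. Pemantle, Towards a theory of negative dependence, J. Math. Phys. 41 (2000) — Conjecture 4,
  §2.4 (truncations).
-/

noncomputable section

open Finset
open Literature.Probability.Distributions
open Literature.Combinatorics.Sahi2008
open Literature.Combinatorics.StablePolynomials
open Literature.Probability.MarkovChains (StochDom lawMean)
open Literature.Combinatorics.LorentzianPolynomials (IsUltraLogConcave)

universe u

namespace Literature.Probability.NegativeDependence

/-! ## §1 Positive rescaling -/

section Smul

variable {σ : Type u} [Fintype σ] [DecidableEq σ]

omit [Fintype σ] in
/-- Conditioning commutes with rescaling. [cite: BorceaBrandenLiggett2007, §2.1 (conditioning)] -/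
theorem pin_smul (I O : Finset σ) (c : ℝ) (μ : Finset σ → ℝ) : pin I O (c • μ) = c • pin I O μ := by
  funext S
  rw [pin_apply, Pi.smul_apply, Pi.smul_apply, pin_apply, smul_eq_mul, smul_eq_mul]
  split_ifs <;> simp

omit [Fintype σ] [DecidableEq σ] in
/-- External fields commute with rescaling. [cite: BorceaBrandenLiggett2007, §2.1 (external fields)] -/
theorem extField_smul (a : σ → ℝ) (c : ℝ) (μ : Finset σ → ℝ) : extField a (c • μ) = c • extField a μ := by
  funext S
  rw [extField_apply, Pi.smul_apply, Pi.smul_apply, extField_apply, smul_eq_mul, smul_eq_mul, mul_assoc]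

/-- Projections commute with rescaling. [cite: BorceaBrandenLiggett2007, §2.1 (projections)] -/
theorem projectOn_smul (T : Finset σ) (c : ℝ) (μ : Finset σ → ℝ) : projectOn T (c • μ) = c • projectOn T μ := by
  funext S
  rw [projectOn_apply, Pi.smul_apply, projectOn_apply, smul_eq_mul, Finset.mul_sum]
  refine Finset.sum_congr rfl fun U _ => ?_
  split_ifs <;> simp

omit [DecidableEq σ] in
/-- `∫ H d(cμ) = c ∫ H dμ`. [cite: BorceaBrandenLiggett2007, §2.1 Def. 2.7] -/
theorem ex_smul_weight (c : ℝ) (μ H : Finset σ → ℝ) : ex (c • μ) H = c * ex μ H := by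
  rw [ex_def, ex_def, Finset.mul_sum]
  exact Finset.sum_congr rfl fun S _ => by rw [Pi.smul_apply, smul_eq_mul, mul_assoc]

omit [DecidableEq σ] in
/-- `(cμ)(Ω) = c μ(Ω)`. [cite: BorceaBrandenLiggett2007, §2.1] -/
theorem mass_smul (c : ℝ) (μ : Finset σ → ℝ) : mass (c • μ) = c * mass μ := by
  rw [mass_def, mass_def, Finset.mul_sum]
  exact Finset.sum_congr rfl fun S _ => by rw [Pi.smul_apply, smul_eq_mul]

/-- NA is invariant under rescaling by `c ≥ 0` (both sides scale by `c²`). [cite: BorceaBrandenLiggett2007,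
§2.1 Def. 2.7] -/
theorem IsNegAssoc.smul {μ : Finset σ → ℝ} (h : IsNegAssoc μ) {c : ℝ} (hc : 0 ≤ c) : IsNegAssoc (c • μ) := by
  intro F G hF hG E₁ E₂ hFE hGE hdisj
  rw [ex_smul_weight, ex_smul_weight, ex_smul_weight, mass_smul]
  have key := h hF hG hFE hGE hdisj
  calc c * ex μ (F * G) * (c * mass μ) = (c * c) * (ex μ (F * G) * mass μ) := by ring
    _ ≤ (c * c) * (ex μ F * ex μ G) := mul_le_mul_of_nonneg_left key (mul_nonneg hc hc)
    _ = c * ex μ F * (c * ex μ G) := by ring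

/-- CNA is invariant under rescaling by `c ≥ 0`. [cite: BorceaBrandenLiggett2007, §2.1 Def. 2.7] -/
theorem IsCNA.smul {μ : Finset σ → ℝ} (h : IsCNA μ) {c : ℝ} (hc : 0 ≤ c) : IsCNA (c • μ) := fun I O => by
  rw [pin_smul]
  exact (h I O).smul hc

/-- CNA+ is invariant under rescaling by `c ≥ 0`. [cite: BorceaBrandenLiggett2007, §2.1 Def. 2.7] -/
theorem IsCNAPlus.smul {μ : Finset σ → ℝ} (h : IsCNAPlus μ) {c : ℝ} (hc : 0 ≤ c) : IsCNAPlus (c • μ) :=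
  fun a ha S => by
  rw [extField_smul, projectOn_smul]
  exact (h a ha S).smul hc

omit [Fintype σ] [DecidableEq σ] in
/-- Truncations of a rescaled weight. [cite: BorceaBrandenLiggett2007, §2.4 Def. 2.15] -/
theorem truncW_smul (p q : ℕ) (c : ℝ) (μ : Finset σ → ℝ) : truncW p q (c • μ) = c • truncW p q μ := by
  funext S
  rw [truncW_apply, Pi.smul_apply, Pi.smul_apply, truncW_apply, smul_eq_mul, smul_eq_mul]
  split_ifs <;> simp

omit [DecidableEq σ] in
/-- The normalized truncations `μ_{p,q}` do not see a rescaling by `c ≠ 0`. [cite: BorceaBrandenLiggett2007,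
§2.4 Def. 2.15] -/
theorem truncMeasure_smul (p q : ℕ) {c : ℝ} (hc : c ≠ 0) (μ : Finset σ → ℝ) :
    truncMeasure p q (c • μ) = truncMeasure p q μ := by
  funext S
  rw [truncMeasure_apply, truncMeasure_apply, truncW_smul, mass_smul, Pi.smul_apply, smul_eq_mul,
    mul_div_mul_left _ _ hc]

end Smul

/-! ## §2 The counterexample weight is CNA+ -/

section CE

/-- `b/m = ceB'` is LC (condition (i) at `λ = 0`). [cite: BorceaBrandenLiggett2007, §7 Counterexample 1] -/
theorem isLogConcaveSeq_ceB' : IsLogConcaveSeq ceB' := by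
  have h := isLogConcaveSeq_ceA_ceB' (l := 0) le_rfl
  simpa only [zero_mul, zero_add] using h

/-- **The 20-variable counterexample weight is CNA+** ("let `μ` be the corresponding probability measure in
`𝔓_{n+1}`, so that `μ` is CNA+" — by Corollary 6.5: `a`, `b` LC, `{λ a_k + b_k}` LC for all `λ ≥ 0`, (ii)).
[cite: BorceaBrandenLiggett2007, §7 Counterexamples 1–2; §6 Cor. 6.5] -/
theorem isCNAPlus_ceWeight : IsCNAPlus ceWeight :=
  isCNAPlus_almostExch isLogConcaveSeq_ceA isLogConcaveSeq_ceB' (fun _ hl => isLogConcaveSeq_ceA_ceB' hl.le)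
    condition_ii_ce

/-- The counterexample weight is CNA. [cite: BorceaBrandenLiggett2007, §7 Counterexample 1; §6 Thm. 6.4] -/
theorem isCNA_ceWeight : IsCNA ceWeight := isCNAPlus_ceWeight.isCNA

/-- The counterexample weight is NA. [cite: BorceaBrandenLiggett2007, §7 Counterexample 1; §6 Thm. 6.4] -/
theorem isNegAssoc_ceWeight : IsNegAssoc ceWeight := isCNA_ceWeight.isNegAssoc

end CE

/-! ## §3 Conjectures 2.3, 2.5, 2.9 fail -/

section Conjectures

/-- The normalized counterexample: a probability measure on `2^[20]`. [cite: BorceaBrandenLiggett2007, §7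
Counterexample 1] -/
theorem ceProb_spec :
    (∀ U, 0 ≤ ((mass ceWeight)⁻¹ • ceWeight) U) ∧ mass ((mass ceWeight)⁻¹ • ceWeight) = 1 ∧
      ¬ IsUltraLogConcave 20 (rankSeq ((mass ceWeight)⁻¹ • ceWeight)) := by
  have hm : 0 < (mass ceWeight)⁻¹ := inv_pos.2 mass_ceWeight_pos
  refine ⟨fun U => ?_, ?_, fun h => not_isUltraLogConcave_rankSeq_ceWeight fun k hk hkd => ?_⟩
  · rw [Pi.smul_apply, smul_eq_mul]
    exact mul_nonneg hm.le (ceWeight_nonneg U)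
  · rw [mass_smul, inv_mul_cancel₀ mass_ceWeight_pos.ne']
  · have key := h k hk hkd
    rw [rankSeq_smul, rankSeq_smul, rankSeq_smul] at key
    have h2 : (mass ceWeight)⁻¹ * rankSeq ceWeight (k - 1) / ((20 : ℕ).choose (k - 1) : ℝ) *
        ((mass ceWeight)⁻¹ * rankSeq ceWeight (k + 1) / ((20 : ℕ).choose (k + 1) : ℝ)) =
        (mass ceWeight)⁻¹ ^ 2 * (rankSeq ceWeight (k - 1) / ((20 : ℕ).choose (k - 1) : ℝ) *
          (rankSeq ceWeight (k + 1) / ((20 : ℕ).choose (k + 1) : ℝ))) := by ring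
    have h3 : ((mass ceWeight)⁻¹ * rankSeq ceWeight k / ((20 : ℕ).choose k : ℝ)) ^ 2 =
        (mass ceWeight)⁻¹ ^ 2 * (rankSeq ceWeight k / ((20 : ℕ).choose k : ℝ)) ^ 2 := by ring
    rw [h2, h3] at key
    exact le_of_mul_le_mul_left key (pow_pos hm 2)

/-- **Conjecture 2.5 fails** ("If `μ ∈ 𝔓_n` is CNA+ then it is ULC"): a CNA+ probability measure on `2^[20]`
whose rank sequence is not ULC. [cite: BorceaBrandenLiggett2007, §2.1 Conj. 2.5; §7 Counterexample 1
("both Conjecture 2.4 and Conjecture 2.5 fail whenever … `n+1 ≥ 20`")] -/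
theorem BorceaBrandenLiggett_conjecture_2_5_fails :
    ∃ μ : Finset (Option (Fin 19)) → ℝ,
      (∀ U, 0 ≤ μ U) ∧ mass μ = 1 ∧ IsCNAPlus μ ∧ ¬ IsUltraLogConcave 20 (rankSeq μ) :=
  ⟨(mass ceWeight)⁻¹ • ceWeight, ceProb_spec.1, ceProb_spec.2.1,
    isCNAPlus_ceWeight.smul (inv_nonneg.2 mass_ceWeight_pos.le), ceProb_spec.2.2⟩

/-- **Conjecture 2.3 fails** ("If `μ ∈ 𝔓_n` is NA then it is ULC"): the same measure is NA (indeed CNA+).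
[cite: BorceaBrandenLiggett2007, §2.1 Conj. 2.3, Fig. 1 (CNA+ ⟹ CNA ⟹ NA); §7 Counterexample 1] -/
theorem BorceaBrandenLiggett_conjecture_2_3_fails :
    ∃ μ : Finset (Option (Fin 19)) → ℝ,
      (∀ U, 0 ≤ μ U) ∧ mass μ = 1 ∧ IsNegAssoc μ ∧ ¬ IsUltraLogConcave 20 (rankSeq μ) :=
  ⟨(mass ceWeight)⁻¹ • ceWeight, ceProb_spec.1, ceProb_spec.2.1,
    isNegAssoc_ceWeight.smul (inv_nonneg.2 mass_ceWeight_pos.le), ceProb_spec.2.2⟩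

/-- **Conjecture 2.9 fails** ("Suppose that `μ` is CNA+ and that `μ({|S| = k}) μ({|S| = k+1}) > 0`. Then
`μ_k ≼ μ_{k+1}`"): the normalized counterexample is a CNA+ probability measure with `r_3 r_4 > 0` and
`μ_3 ⋠ μ_4`. [cite: BorceaBrandenLiggett2007, §2.4 Conj. 2.9; §7 Counterexample 2] -/
theorem BorceaBrandenLiggett_conjecture_2_9_fails :
    ∃ μ : Finset (Option (Fin 19)) → ℝ,
      (∀ U, 0 ≤ μ U) ∧ mass μ = 1 ∧ IsCNAPlus μ ∧ 0 < rankSeq μ 3 * rankSeq μ 4 ∧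
        ¬ StochDom (truncMeasure 3 3 μ) (truncMeasure 4 4 μ) := by
  have hm : 0 < (mass ceWeight)⁻¹ := inv_pos.2 mass_ceWeight_pos
  refine ⟨(mass ceWeight)⁻¹ • ceWeight, ceProb_spec.1, ceProb_spec.2.1, isCNAPlus_ceWeight.smul hm.le, ?_, ?_⟩
  · rw [rankSeq_smul, rankSeq_smul]
    have := BorceaBrandenLiggett_counterexample_2.2.1
    calc (0 : ℝ) < ((mass ceWeight)⁻¹ * (mass ceWeight)⁻¹) * (rankSeq ceWeight 3 * rankSeq ceWeight 4) :=
          mul_pos (mul_pos hm hm) this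
      _ = (mass ceWeight)⁻¹ * rankSeq ceWeight 3 * ((mass ceWeight)⁻¹ * rankSeq ceWeight 4) := by ring
  · rw [truncMeasure_smul 3 3 hm.ne', truncMeasure_smul 4 4 hm.ne']
    exact BorceaBrandenLiggett_counterexample_2.2.2

end Conjectures

end Literature.Probability.NegativeDependence

end
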